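import Summits.QuantumFields.YangMills.Theorems.MirrorModularBoostsCurvatureBoostCovarianceRayPositivity
import Summits.QuantumFields.YangMills.Theorems.MirrorModularBoostsCurvatureBoostCovarianceParitySieve

/-!
# Boosted vectors of type `< 4` kill the layers `|k| ≥ 2` — stub `stub_levelGrowthHigh_of_boostType`

Line `Sketch` of crux `MirrorModularBoosts.SoftKernelBoostCovariance` (stmt-QuantumFields-14999), stub (5b') of the
registered skeleton `Cruxes/SoftKernelBoostCovariance/Lines/Sketch.lean`.  Model-blind OS bookkeeping over the landed
ray-positivity files of the parent line `boosts-inherit-mirrors` (stmt-QuantumFields-9663):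
`MirrorModularBoostsCurvatureBoostCovarianceRayPositivityCore` / `…RayPositivity` (rotation margin of a compact
time-ordered support, the orbit function as a matrix element, the identity theorem on the strip) and the reflection
lemma `Sieve.laurent_reflect` of `…ParitySieve`.

**Statement** (the registered signature, verbatim).  FIRST HYPOTHESIS — the statement of the neighbouring stub (L3)
`stub_laurentLayers`, NOT proved here: sub-threshold ray growth `‖Σ_{|k| ≤ K} p_k s^k‖ ≤ C e^{cχ}` (`s = e^{-4χ}`,
`χ ≥ 0`, `c < 8`) of a finite Laurent sum kills its layers `k ≤ -2`.  THEN: for a one-species family `S₁` on `ℝ⁴` with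
an `e₀`-reconstruction `h` (`OSReconstructionNoE1`), a compactly supported `e₀`-time-ordered `F` of degree `a` whose
boosted OS vectors `θ ↦ Ψ_{R_θ F}` (`R_θ = planeRot 0 θ`, the rotation of the `(x₀,x₁)`-plane) extend to a map `V`
holomorphic on a strip `{|Re θ| < ε}` with `‖V θ‖ ≤ C' e^{N'|Im θ|}` and `N' < 4`, and a witness `H` of the doubled
test function `ΘF* ⊗ F` whose orbit function `θ ↦ 𝔖_{2a}(R_θ H)` is the trigonometric polynomial
`Σ_{|k| ≤ K} p_k e^{4ikθ}`: `p_k = 0` whenever `|k| ≥ 2`.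

**Proof.**  Shrink `ε` below the rotation margin of the compact time-ordered support
(`RayPositivity.exists_isTimeOrdered_planeRot`), so that `R_{±θ} F` stay time-ordered for real `|θ| < ε`; there
`𝔖(R_θ H) = ⟪Ψ_{R_{-θ}F}, Ψ_{R_θ F}⟫ = ⟪V(-θ), V(θ)⟫` (`RayPositivity.orbit_eq_inner`), and the identity theorem on
the strip (`RayPositivity.pencil_eq_inner`) gives `Σ p_k e^{-4kχ} = ⟪V(iχ), V(iχ)⟫` for EVERY real `χ`, whence
`‖Σ p_k e^{-4kχ}‖ ≤ ‖V(iχ)‖² ≤ C'² e^{2N'|χ|}` (Cauchy–Schwarz and the type bound at `Re (iχ) = 0`;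
`norm_pencil_le`).  Since `2N' < 8`, (L3) along `χ → +∞` kills the layers `k ≤ -2`; the reflected sum
`Σ p_{-k} s^k = Σ p_k (s⁻¹)^k` (`Sieve.laurent_reflect`, `s⁻¹ = e^{-4(-χ)}`) is the same pencil at `-χ`, so (L3)
applied to `k ↦ p_{-k}` kills the layers `k ≥ 2`.

References: Osterwalder–Schrader, *Axioms for Euclidean Green's functions* (1973), §4 (Euclidean covariance by
analytic continuation in the rotation angle); Glimm–Jaffe, *Quantum Physics* (1987), §6.1 (Gram forms of OS field
vectors).
-/

noncomputable section

namespace Summit.QuantumFields.YangMills.Theorems.SoftKernelBoostCovariance.Sketch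

open scoped BigOperators SchwartzMap InnerProductSpace
open Literature.MathematicalPhysics.QuantumLattice Literature.MathematicalPhysics.AQFT
  Literature.MathematicalPhysics.QuantumFieldTheory
open Summit.QuantumFields.YangMills.Theorems.NPointIsotropy.Negative (E4)
open Summit.QuantumFields.YangMills.Theorems.CurvatureBoostCovariance.BoostsInheritMirrors.RayPositivity
  (pencil_eq_inner orbit_eq_inner exists_isTimeOrdered_planeRot)
open Summit.QuantumFields.YangMills.Theorems.CurvatureBoostCovariance.BoostsInheritMirrors.Sieve
  (laurent_reflect)

/-- **Squared-norm bound of a self-pairing pencil.**  If `V` is holomorphic on the strip `{|Re θ| < ε}` with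
`‖V θ‖ ≤ C' e^{N'|Im θ|}` there, and the self-pairing `⟪V(-θ), V(θ)⟫` is the trigonometric polynomial
`Σ c_k e^{4ikθ}` on the real segment `|θ| < ε`, then for every real `χ` the Laurent pencil at `s = e^{-4χ}`
(`= ⟪V(iχ), V(iχ)⟫` by `RayPositivity.pencil_eq_inner`) has norm at most `C'² e^{2N'|χ|}`. -/
theorem norm_pencil_le {H : Type*} [NormedAddCommGroup H] [InnerProductSpace ℂ H] {ε : ℝ} (hε : 0 < ε)
    {V : ℂ → H} (hV : DifferentiableOn ℂ V {θ : ℂ | |θ.re| < ε}) {C' N' : ℝ}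
    (hVg : ∀ θ : ℂ, |θ.re| < ε → ‖V θ‖ ≤ C' * Real.exp (N' * |θ.im|))
    (K : ℕ) (c : ℤ → ℂ)
    (hc : ∀ θ : ℝ, |θ| < ε → ⟪V (-(θ : ℂ)), V θ⟫_ℂ =
      ∑ k ∈ Finset.Icc (-(K : ℤ)) K, c k * Complex.exp (4 * (k : ℂ) * (θ : ℂ) * Complex.I))
    (χ : ℝ) :
    ‖∑ k ∈ Finset.Icc (-(K : ℤ)) K, c k * ((Real.exp (-4 * χ) : ℝ) : ℂ) ^ k‖ ≤
      C' ^ 2 * Real.exp (2 * N' * |χ|) := by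
  rw [pencil_eq_inner hε hV hV K c hc χ]
  have hre : |((χ : ℂ) * Complex.I).re| < ε := by simpa using hε
  have hA : ‖V ((χ : ℂ) * Complex.I)‖ ≤ C' * Real.exp (N' * |χ|) := by simpa using hVg _ hre
  have h0 : 0 ≤ C' * Real.exp (N' * |χ|) := (norm_nonneg _).trans hA
  calc ‖⟪V ((χ : ℂ) * Complex.I), V ((χ : ℂ) * Complex.I)⟫_ℂ‖
      ≤ ‖V ((χ : ℂ) * Complex.I)‖ * ‖V ((χ : ℂ) * Complex.I)‖ := norm_inner_le_norm _ _
    _ ≤ (C' * Real.exp (N' * |χ|)) * (C' * Real.exp (N' * |χ|)) := mul_le_mul hA hA (norm_nonneg _) h0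
    _ = C' ^ 2 * Real.exp (2 * N' * |χ|) := by
        rw [show 2 * N' * |χ| = N' * |χ| + N' * |χ| by ring, Real.exp_add]
        ring

/-- **Stub (5b') — BOOSTED VECTORS OF TYPE `< 4` KILL THE LAYERS `|k| ≥ 2`** (model-blind OS bookkeeping; the
registered signature of `Cruxes/SoftKernelBoostCovariance/Lines/Sketch.lean`, verbatim; its first hypothesis is the
statement of the stub (L3) `stub_laurentLayers`).  For a one-species family with an `e₀`-reconstruction `h`, a
compactly supported `e₀`-time-ordered `F` of degree `a` whose boosted OS vectors `V` exist on a strip with exponential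
type `N' < 4`, and a witness `H` of `ΘF* ⊗ F` whose orbit function is the trigonometric polynomial with coefficients
`p`: `p_k = 0` for `|k| ≥ 2`.  Proof: shrink `ε` below the rotation margin of the support
(`RayPositivity.exists_isTimeOrdered_planeRot`); `𝔖(R_θ H) = ⟪V(-θ), V(θ)⟫` on the real segment
(`RayPositivity.orbit_eq_inner`); `‖Σ p_k e^{-4kχ}‖ ≤ C'² e^{2N'|χ|}` for ALL real `χ` (`norm_pencil_le`); (L3) at
`χ → +∞` kills `k ≤ -2`, and applied to `k ↦ p_{-k}` (`Sieve.laurent_reflect`, the pencil at `-χ`) kills `k ≥ 2`. -/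
theorem stub_levelGrowthHigh_of_boostType :
    open Literature.MathematicalPhysics.QuantumLattice Literature.MathematicalPhysics.AQFT
      Literature.MathematicalPhysics.QuantumFieldTheory
      Summit.QuantumFields.YangMills.Theorems.CurvatureBoostCovariance.Negative
      Summit.QuantumFields.YangMills.Theorems.NPointIsotropy.Negative in
    (∀ (K : ℕ) (p : ℤ → ℂ) (C c : ℝ), c < 8 →
      (∀ χ : ℝ, 0 ≤ χ →
        ‖∑ k ∈ Finset.Icc (-(K : ℤ)) K, p k * ((Real.exp (-4 * χ) : ℝ) : ℂ) ^ k‖ ≤ C * Real.exp (c * χ)) →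
      ∀ k ∈ Finset.Icc (-(K : ℤ)) K, k ≤ -2 → p k = 0) →
    ∀ (S₁ : SchwingerFamily E4) (h : OSReconstructionNoE1 S₁.toLabelled)
      (a : ℕ) (F : SchwartzMap (Fin a → E4) ℂ), IsTimeOrdered F → HasCompactSupport (F : (Fin a → E4) → ℂ) →
      (∃ ε : ℝ, 0 < ε ∧ ∃ (V : ℂ → h.Hilbert) (C' N' : ℝ), N' < 4 ∧
        DifferentiableOn ℂ V {θ : ℂ | |θ.re| < ε} ∧
        (∀ θ : ℂ, |θ.re| < ε → ‖V θ‖ ≤ C' * Real.exp (N' * |θ.im|)) ∧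
        ∀ θ : ℝ, |θ| < ε → ∀ hθ : IsTimeOrdered (linActMulti (planeRot (0 : Fin 3) θ) F),
          V θ = h.fieldVec a (fun _ => ()) (linActMulti (planeRot (0 : Fin 3) θ) F) hθ) →
      ∀ H : SchwartzMap (Fin (a + a) → E4) ℂ, IsAppendTensorOf H (osAdjoint F) F →
      ∀ (K : ℕ) (p : ℤ → ℂ),
        (∀ θ : ℝ, S₁ (a + a) (linActMulti (planeRot (0 : Fin 3) θ) H) =
          ∑ k ∈ Finset.Icc (-(K : ℤ)) K, p k * Complex.exp (4 * (k : ℂ) * (θ : ℂ) * Complex.I)) →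
        ∀ k ∈ Finset.Icc (-(K : ℤ)) K, 2 ≤ |k| → p k = 0 := by
  intro hL3 S₁ h a F hF hFc hV H hH K p hp
  obtain ⟨ε, hε, V, C', N', hN', hVd, hVg, hVeq⟩ := hV
  obtain ⟨δ, hδ, hT⟩ := exists_isTimeOrdered_planeRot hF hFc
  -- shrink the strip below the rotation margin of the support
  set ε' : ℝ := min ε δ with hε'_def
  have hε' : 0 < ε' := lt_min hε hδ
  have hle : ε' ≤ ε := min_le_left _ _
  have hVd' : DifferentiableOn ℂ V {θ : ℂ | |θ.re| < ε'} :=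
    hVd.mono fun θ (hθ : |θ.re| < ε') => lt_of_lt_of_le hθ hle
  have hVg' : ∀ θ : ℂ, |θ.re| < ε' → ‖V θ‖ ≤ C' * Real.exp (N' * |θ.im|) :=
    fun θ hθ => hVg θ (lt_of_lt_of_le hθ hle)
  -- time-ordering of the rotated factors and the identification with the boosted vectors
  have tF : ∀ θ : ℝ, |θ| < ε' → IsTimeOrdered (linActMulti (planeRot (0 : Fin 3) θ) F) :=
    fun θ hθ => hT θ (lt_of_lt_of_le hθ (min_le_right _ _))
  have nabs : ∀ θ : ℝ, |θ| < ε' → |(-θ)| < ε' := fun θ hθ => by rwa [abs_neg]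
  have eF : ∀ (θ : ℝ) (hθ : |θ| < ε'),
      V (-(θ : ℂ)) = h.fieldVec a (fun _ => ()) _ (tF (-θ) (nabs θ hθ)) := fun θ hθ => by
    have := hVeq (-θ) (lt_of_lt_of_le (nabs θ hθ) hle) (tF (-θ) (nabs θ hθ))
    push_cast at this
    exact this
  have eF' : ∀ (θ : ℝ) (hθ : |θ| < ε'), V θ = h.fieldVec a (fun _ => ()) _ (tF θ hθ) :=
    fun θ hθ => hVeq θ (lt_of_lt_of_le hθ hle) (tF θ hθ)
  -- the real-segment Gram identity
  have ip : ∀ θ : ℝ, |θ| < ε' → ⟪V (-(θ : ℂ)), V θ⟫_ℂ =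
      ∑ k ∈ Finset.Icc (-(K : ℤ)) K, p k * Complex.exp (4 * (k : ℂ) * (θ : ℂ) * Complex.I) :=
    fun θ hθ => by rw [eF θ hθ, eF' θ hθ, ← orbit_eq_inner h hH θ, hp θ]
  -- the pencil bound at every real `χ`: `‖Σ p_k e^{-4kχ}‖ ≤ C'² e^{2N'|χ|}`
  have nb : ∀ χ : ℝ, ‖∑ k ∈ Finset.Icc (-(K : ℤ)) K, p k * ((Real.exp (-4 * χ) : ℝ) : ℂ) ^ k‖ ≤
      C' ^ 2 * Real.exp (2 * N' * |χ|) := norm_pencil_le hε' hVd' hVg' K p ip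
  have h2N : 2 * N' < 8 := by linarith
  -- the negative layers `k ≤ -2`, by (L3) along `χ → +∞`
  have hneg : ∀ k ∈ Finset.Icc (-(K : ℤ)) K, k ≤ -2 → p k = 0 :=
    hL3 K p (C' ^ 2) (2 * N') h2N fun χ hχ => by
      have := nb χ
      rwa [abs_of_nonneg hχ] at this
  -- the positive layers `k ≥ 2`, by (L3) for the reflected sum (the pencil at `-χ`)
  have nb' : ∀ χ : ℝ, 0 ≤ χ →
      ‖∑ k ∈ Finset.Icc (-(K : ℤ)) K, p (-k) * ((Real.exp (-4 * χ) : ℝ) : ℂ) ^ k‖ ≤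
        C' ^ 2 * Real.exp (2 * N' * χ) := by
    intro χ hχ
    have hs : (Real.exp (-4 * χ))⁻¹ = Real.exp (-4 * (-χ)) := by
      rw [← Real.exp_neg]
      simp only [neg_mul, mul_neg, neg_neg]
    have := nb (-χ)
    rw [abs_neg, abs_of_nonneg hχ, ← hs, Complex.ofReal_inv, ← laurent_reflect K p] at this
    exact this
  have hpos : ∀ k ∈ Finset.Icc (-(K : ℤ)) K, k ≤ -2 → p (-k) = 0 :=
    hL3 K (fun k => p (-k)) (C' ^ 2) (2 * N') h2N nb'
  -- `|k| ≥ 2` is `k ≥ 2` or `k ≤ -2`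
  intro k hk hk2
  rcases le_abs.1 hk2 with h2 | h2
  · have hk' : -k ∈ Finset.Icc (-(K : ℤ)) K := by
      rw [Finset.mem_Icc] at hk ⊢
      omega
    have := hpos (-k) hk' (by omega)
    rwa [neg_neg] at this
  · exact hneg k hk (by omega)

end Summit.QuantumFields.YangMills.Theorems.SoftKernelBoostCovariance.Sketch

end
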